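import Mathlib
import HarnessLib
import Summits.ValiantsHypothesis.ValiantsHypothesis.Theses.MonotoneRestoration
import Literature.Computability.AlgebraicComplexity.ArithCircuit
import Literature.Computability.AlgebraicComplexity.ArithCircuitProofs
import Literature.Computability.AlgebraicComplexity.MonotoneStructure
import Literature.Computability.AlgebraicComplexity.PermanentIrreducible
import Literature.ModelTheory.FiniteModelTheory.CkEquiv
import Summits.ValiantsHypothesis.ValiantsHypothesis.Theorems.MonotoneRestorationMonotoneRestorationQPCosetCount
import Summits.ValiantsHypothesis.ValiantsHypothesis.Theorems.MonotoneRestorationMonotoneRestorationQPSymmetricLB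
import Summits.ValiantsHypothesis.ValiantsHypothesis.Theorems.MonotoneRestorationMonotoneRestorationQPSupportSymmetrisation
import Summits.ValiantsHypothesis.ValiantsHypothesis.Theorems.MonotoneRestorationMonotoneRestorationQPSparseRegime
import Summits.ValiantsHypothesis.ValiantsHypothesis.Theorems.MonotoneRestorationMonotoneRestorationQPBeta
import Literature.Computability.AlgebraicComplexity.SymmetricArithCircuit
import Literature.Computability.AlgebraicComplexity.DawarWilsenach2025Proofs
import Literature.GroupTheory.PermutationGroups.SmallIndexSubgroups
import Summits.ValiantsHypothesis.ValiantsHypothesis.Theorems.MonotoneRestorationQP.Negative.LoadBearing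
import Summits.ValiantsHypothesis.ValiantsHypothesis.Theorems.MonotoneRestorationMonotoneRestorationQPPermSupportCount

/-! TTRL-lite variant V19828 of stmt-ValiantsHypothesis-15886 -/

set_option linter.dupNamespace false

namespace Summit.ValiantsHypothesis.ValiantsHypothesis.Theorems

open Summit.ValiantsHypothesis.ValiantsHypothesis.Theses.MonotoneRestoration
open Literature.Computability.AlgebraicComplexity

/-- Helper for TTRL-lite variant V19828 of `stmt-ValiantsHypothesis-15886`: if `q * k ≤ n` then
`q ^ k ≤ n.choose k`. Proof by induction on `k` via the absorption identity
`(m + 1) * m.choose k = (m + 1).choose (k + 1) * (k + 1)` (`Nat.add_one_mul_choose_eq`):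
`(k + 1) q^(k+1) = (q (k+1)) q^k ≤ (m + 1) · C(m, k) = C(m+1, k+1) (k+1)`. -/
theorem pow_le_choose_of_mul_le_var19828 :
    ∀ (k n q : ℕ), q * k ≤ n → q ^ k ≤ n.choose k := by
  intro k
  induction k with
  | zero => intro n q _; simp
  | succ k ih =>
    intro n q h
    rcases Nat.eq_zero_or_pos q with rfl | hq
    · simp
    cases n with
    | zero =>
      have : q * (k + 1) = 0 := Nat.le_zero.mp h
      simp at this
      omega
    | succ m =>
      have hk : q * k ≤ m := by
        have : q * (k + 1) = q * k + q := by ring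
        omega
      have hih := ih m q hk
      have key : (m + 1) * m.choose k = (m + 1).choose (k + 1) * (k + 1) :=
        Nat.add_one_mul_choose_eq m k
      have hmul : q ^ (k + 1) * (k + 1) ≤ (m + 1).choose (k + 1) * (k + 1) := by
        calc q ^ (k + 1) * (k + 1) = (q * (k + 1)) * q ^ k := by ring
          _ ≤ (m + 1) * m.choose k := Nat.mul_le_mul h hih
          _ = (m + 1).choose (k + 1) * (k + 1) := key
      exact Nat.le_of_mul_le_mul_right hmul (Nat.succ_pos k)

/-- TTRL-lite variant V19828 of `stmt-ValiantsHypothesis-15886`: the classical binomial lower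
bound `(n / k) ^ k ≤ n.choose k` in floor-division `ℕ` form (the hypothesis `0 < k` is not
needed: at `k = 0` both sides are `1`). From `pow_le_choose_of_mul_le_var19828` with
`q := n / k` and `n / k * k ≤ n` (`Nat.div_mul_le_self`). -/
theorem stub_gammaArithmetic_var19828 :
    ∀ (n k : ℕ), 0 < k → (n / k) ^ k ≤ n.choose k :=
  fun n k _ => pow_le_choose_of_mul_le_var19828 k n (n / k) (Nat.div_mul_le_self n k)

end Summit.ValiantsHypothesis.ValiantsHypothesis.Theorems
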